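import Literature.NumberTheory.EllipticCurves.PAdicPowerSeriesEvaluationProofs
import Mathlib.LinearAlgebra.Lagrange
import Mathlib.Algebra.Polynomial.Div
import HarnessLib

/-!
# The `λ`-CERTIFICATE by divided differences for an element of `Λ = ℤ_p⟦T⟧` known through its values:
# `ord_T(g mod p) = a` from `a + 1` values `g(x_0), …, g(x_a)` at points of `pℤ_p` (Greenberg 2001 §4
# p. 356: "if `t₁, t₂ ∈ pℤ_p`, then `g_i(t₁) − g_i(t₂) ≡ b₁^{(i)}(t₁ − t₂) (mod p²ℤ_p)`") — THEOREMS

HONEST FRAMING (cell `bsd-eis`, seat `bsd-eis-x3` gen 3; home `run/shared/lean/pub/bsd-eis/`):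
theorems only, no named fact, no new definition. The X3 certificate road
(`Summits/…/Additive/X3BranchResidualCountOfCharacterFacts.lean`) displays, per pair, two ANALYTIC
certificates `ord_T(L_{Σ₀}(C ⊗ χ, T) mod p) = a`, `ord_T(L_{Σ₀}(D ⊗ χ, T) mod p) = b` about elements of
`Λ` that are known ONLY through their interpolation values (`IsCharacterLFunctionC/D`). This file is
the kernel that turns finitely many such values into the order: for `g = ∑ cₙ Tⁿ ∈ ℤ_p⟦T⟧` and
distinct nodes `x_0, …, x_j ∈ pℤ_p`, the top divided difference of `k ↦ g(x_k)` in Lagrange form,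
`L_j = ∑_{i ≤ j} g(x_i) / ∏_{k ≠ i} (x_i − x_k)`, satisfies `L_j ≡ c_j (mod pℤ_p)` — Greenberg's
congruence (the case `j = 1`) in general: `L_j = ∑ₙ cₙ H_{n,j}` with `H_{n,j} = ∑_i x_iⁿ/∏(x_i − x_k)`
the `X^j`-coefficient of the Lagrange interpolant of `Xⁿ` on the nodes (Mathlib
`Lagrange.coeff_eq_sum`), which is `0` for `n < j`, `1` for `n = j`, and for `n > j` the
`X^j`-coefficient of `Xⁿ mod ∏(X − x_i)`, a polynomial that vanishes mod `p` because
`∏(X − x_i) ≡ X^{j+1} (mod p)`. Hence: `‖L_j‖ < 1 ⟺ c_j ∈ pℤ_p`, and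
(`‖L_j‖ < 1` for `j < a`, `‖L_a‖ = 1`) ⟹ `ord_T(g mod p) = a`.

* §1 `sum_pow_div_prod_sub_eq_ite` (`n ≤ j`), `exists_coeff_sum_pow_div_prod_sub_of_lt` (`n > j`:
  the Lagrange sum is an element of `pℤ_p`);
* §2 `exists_lagrangeSum_eq_coeff_add` (`L_j = c_j + t`, `‖t‖ ≤ p⁻¹`), `norm_lagrangeSum_lt_one_iff`;
* §3 **`order_toNat_eq_of_lagrangeSum`** — the certificate.

The instances for `L_{Σ₀}(C ⊗ χ, T)` / `L_{Σ₀}(D ⊗ χ, T)` at the nodes `x_k = κ(γ)^{±k} − 1` are in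
`GreenbergVatsal2000/CharacterLambdaCertificateProofs.lean`.

References: [Greenberg2001PastPresent] §4 pp. 355–356; [LangCyclotomic1990] Ch. 4 §1 Thm. 1.2 (values
of elements of `𝔬⟦X⟧`), Ch. 5 §2 (Weierstrass degree = `ord_T mod p`).
-/

noncomputable section

open scoped Classical

open Polynomial Finset Filter Topology

namespace Literature.NumberTheory.EllipticCurves

variable {p : ℕ} [Fact p.Prime]

/-! ## §1 The Lagrange sums `H_{n,j} = ∑_{i ≤ j} x_iⁿ / ∏_{k ≠ i} (x_i − x_k)` of the monomials -/

/-- **`H_{n,j} = [n = j]` for `n ≤ j`**: the `X^j`-coefficient of the Lagrange interpolant of `Xⁿ` on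
`j + 1` distinct nodes is that of `Xⁿ` itself (Mathlib `Lagrange.coeff_eq_sum`).
[cite: Greenberg2001PastPresent, §4 p. 356] -/
theorem sum_pow_div_prod_sub_eq_ite (x : ℕ → ℚ_[p]) {j n : ℕ} (hinj : Set.InjOn x (range (j + 1)))
    (hn : n ≤ j) :
    ∑ i ∈ range (j + 1), x i ^ n / ∏ k ∈ (range (j + 1)).erase i, (x i - x k) =
      if n = j then 1 else 0 := by
  have hcard : #(range (j + 1)) = j + 1 := card_range _
  have hdeg : (X ^ n : ℚ_[p][X]).degree < #(range (j + 1)) := by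
    rw [hcard, degree_X_pow]; exact_mod_cast Nat.lt_succ_of_le hn
  have h := Lagrange.coeff_eq_sum hinj hdeg
  rw [hcard, Nat.add_sub_cancel, coeff_X_pow] at h
  simp only [eval_pow, eval_X] at h
  rw [← h]
  by_cases hnj : n = j
  · rw [if_pos hnj, if_pos hnj.symm]
  · rw [if_neg hnj, if_neg (Ne.symm hnj)]

/-- The nodal polynomial `∏ (X − x_i)` commutes with ring maps. [folklore] -/
private theorem map_nodal {R S : Type*} [CommRing R] [CommRing S] (f : R →+* S) (s : Finset ℕ)
    (v : ℕ → R) : (Lagrange.nodal s v).map f = Lagrange.nodal s (f ∘ v) := by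
  rw [Lagrange.nodal_eq, Lagrange.nodal_eq, Polynomial.map_prod]
  simp only [Polynomial.map_sub, map_X, map_C, Function.comp_apply]

/-- **`H_{n,j} ∈ pℤ_p` for `n > j` and nodes in `pℤ_p`**: `H_{n,j}` is the `X^j`-coefficient of
`R = Xⁿ mod ∏_{i≤j}(X − x_i) ∈ ℤ_p[X]` (Lagrange on `R`, which takes the values `x_iⁿ` at the nodes),
and `R ≡ Xⁿ mod X^{j+1} = 0 (mod p)` because every `x_i ≡ 0 (mod p)`.
[cite: Greenberg2001PastPresent, §4 p. 356] -/
theorem exists_coeff_sum_pow_div_prod_sub_of_lt (x : ℕ → ℤ_[p]) (hx : ∀ i, ‖x i‖ < 1) {j n : ℕ}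
    (hinj : Set.InjOn (fun i ↦ (x i : ℚ_[p])) (range (j + 1))) (hn : j < n) :
    ∃ y : ℤ_[p], ‖y‖ < 1 ∧
      (y : ℚ_[p]) = ∑ i ∈ range (j + 1),
        (x i : ℚ_[p]) ^ n / ∏ k ∈ (range (j + 1)).erase i, ((x i : ℚ_[p]) - x k) := by
  set N : ℤ_[p][X] := Lagrange.nodal (range (j + 1)) x with hN
  have hNm : N.Monic := Lagrange.nodal_monic
  set R : ℤ_[p][X] := X ^ n %ₘ N with hR
  -- over `ℚ_p`: `R` interpolates `Xⁿ` at the nodes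
  have hmapN : N.map (PadicInt.Coe.ringHom (p := p)) =
      Lagrange.nodal (range (j + 1)) (fun i ↦ (x i : ℚ_[p])) := by
    rw [hN, map_nodal]; rfl
  have hNm' : (N.map (PadicInt.Coe.ringHom (p := p))).Monic := hNm.map _
  have hmapR : R.map (PadicInt.Coe.ringHom (p := p)) = X ^ n %ₘ N.map (PadicInt.Coe.ringHom (p := p)) := by
    rw [hR, Polynomial.map_modByMonic _ hNm, Polynomial.map_pow, map_X]
  have hcard : #(range (j + 1)) = j + 1 := card_range _
  have hdegR : (R.map (PadicInt.Coe.ringHom (p := p))).degree < #(range (j + 1)) := by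
    rw [hmapR, hcard]
    calc (X ^ n %ₘ N.map (PadicInt.Coe.ringHom (p := p))).degree
        < (N.map (PadicInt.Coe.ringHom (p := p))).degree := degree_modByMonic_lt _ hNm'
      _ = #(range (j + 1)) := by rw [hmapN, Lagrange.degree_nodal]
      _ = (j + 1 : ℕ) := by rw [hcard]
  have heval : ∀ i ∈ range (j + 1),
      (R.map (PadicInt.Coe.ringHom (p := p))).eval (x i : ℚ_[p]) = (x i : ℚ_[p]) ^ n := by
    intro i hi
    have h := congrArg (Polynomial.eval (x i : ℚ_[p]))
      (modByMonic_add_div (X ^ n : ℚ_[p][X]) (N.map (PadicInt.Coe.ringHom (p := p))))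
    rw [eval_add, eval_mul, hmapN, Lagrange.eval_nodal_at_node (v := fun i ↦ (x i : ℚ_[p])) hi,
      zero_mul, add_zero, eval_pow, eval_X] at h
    rw [hmapR, hmapN, h]
  have hsum := Lagrange.coeff_eq_sum hinj hdegR
  rw [hcard, Nat.add_sub_cancel, Polynomial.coeff_map] at hsum
  change ((R.coeff j : ℤ_[p]) : ℚ_[p]) = _ at hsum
  refine ⟨R.coeff j, ?_, ?_⟩
  · -- `R ≡ 0 (mod p)`
    rw [PadicInt.norm_lt_one_iff_dvd, ← Ideal.mem_span_singleton, ← PadicInt.maximalIdeal_eq_span_p,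
      ← PadicInt.ker_toZMod, RingHom.mem_ker, ← Polynomial.coeff_map, hR,
      Polynomial.map_modByMonic _ hNm, Polynomial.map_pow, map_X, hN, map_nodal]
    have h0 : (PadicInt.toZMod (p := p)) ∘ x = fun _ ↦ 0 := by
      funext i
      rw [Function.comp_apply, ← RingHom.mem_ker, PadicInt.ker_toZMod, PadicInt.maximalIdeal_eq_span_p,
        Ideal.mem_span_singleton, ← PadicInt.norm_lt_one_iff_dvd]
      exact hx i
    rw [h0]
    have hnod : Lagrange.nodal (range (j + 1)) (fun _ : ℕ ↦ (0 : ZMod p)) = X ^ (j + 1) := by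
      rw [Lagrange.nodal_eq]; simp
    rw [hnod, (modByMonic_eq_zero_iff_dvd (monic_X_pow _)).mpr (pow_dvd_pow X hn), coeff_zero]
  · rw [hsum]
    refine Finset.sum_congr rfl fun i hi ↦ ?_
    rw [heval i hi]

/-! ## §2 The top divided difference `L_j` of the values of `g` is `≡ c_j (mod pℤ_p)` -/

/-- **`L_j = c_j + t` with `‖t‖ ≤ p⁻¹`** for `g = ∑ cₙ Tⁿ ∈ ℤ_p⟦T⟧`, distinct nodes `x_0, …, x_j ∈ pℤ_p`
and `L_j = ∑_{i≤j} g(x_i)/∏_{k≠i}(x_i − x_k)`: `L_j = ∑ₙ cₙ H_{n,j}` and §1. Greenberg 2001 p. 356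
prints the case `j = 1`. [cite: Greenberg2001PastPresent, §4 p. 356] -/
theorem exists_lagrangeSum_eq_coeff_add {g : PowerSeries ℤ_[p]} (x : ℕ → ℤ_[p]) (hx : ∀ i, ‖x i‖ < 1)
    {j : ℕ} (hinj : Set.InjOn (fun i ↦ (x i : ℚ_[p])) (range (j + 1))) (v : ℕ → ℚ_[p])
    (hv : ∀ i ∈ range (j + 1),
      HasSum (fun n ↦ ((PowerSeries.coeff n g : ℤ_[p]) : ℚ_[p]) * (x i : ℚ_[p]) ^ n) (v i)) :
    ∃ t : ℚ_[p], ‖t‖ ≤ (p : ℝ)⁻¹ ∧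
      ∑ i ∈ range (j + 1), v i / ∏ k ∈ (range (j + 1)).erase i, ((x i : ℚ_[p]) - x k) =
        ((PowerSeries.coeff j g : ℤ_[p]) : ℚ_[p]) + t := by
  have pp : p.Prime := Fact.out
  set D : ℕ → ℚ_[p] := fun i ↦ ∏ k ∈ (range (j + 1)).erase i, ((x i : ℚ_[p]) - x k) with hD
  set H : ℕ → ℚ_[p] := fun n ↦ ∑ i ∈ range (j + 1), (x i : ℚ_[p]) ^ n / D i with hH
  set c : ℕ → ℚ_[p] := fun n ↦ ((PowerSeries.coeff n g : ℤ_[p]) : ℚ_[p]) with hc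
  -- `L_j = ∑ₙ cₙ H_{n,j}`
  have hL : HasSum (fun n ↦ c n * H n) (∑ i ∈ range (j + 1), v i / D i) := by
    have h := hasSum_sum (s := range (j + 1))
      (f := fun i n ↦ c n * (x i : ℚ_[p]) ^ n / D i) (a := fun i ↦ v i / D i)
      (fun i hi ↦ (hv i hi).div_const (D i))
    have hfun : (fun n ↦ ∑ i ∈ range (j + 1), c n * (x i : ℚ_[p]) ^ n / D i) = fun n ↦ c n * H n := by
      funext n
      rw [hH, Finset.mul_sum]
      refine Finset.sum_congr rfl fun i _ ↦ ?_
      rw [mul_div_assoc]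
    rw [hfun] at h
    exact h
  -- the values of `H`
  have hHle : ∀ n ≤ j, H n = if n = j then 1 else 0 := fun n hn ↦
    sum_pow_div_prod_sub_eq_ite (fun i ↦ (x i : ℚ_[p])) hinj hn
  have hHgt : ∀ n, j < n → ‖c n * H n‖ ≤ (p : ℝ)⁻¹ := by
    intro n hn
    obtain ⟨y, hy, hyH⟩ := exists_coeff_sum_pow_div_prod_sub_of_lt x hx hinj hn
    have hyH' : H n = (y : ℚ_[p]) := hyH.symm
    rw [hyH', hc, ← PadicInt.coe_mul, PadicInt.padic_norm_e_of_padicInt]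
    obtain ⟨z, hz⟩ := (PadicInt.norm_lt_one_iff_dvd y).mp hy
    rw [hz, ← mul_assoc, mul_comm _ (p : ℤ_[p]), mul_assoc, norm_mul, PadicInt.norm_p]
    exact mul_le_of_le_one_right (by positivity) (PadicInt.norm_le_one _)
  -- split off the term `n = j`
  set f : ℕ → ℚ_[p] := Function.update (fun n ↦ c n * H n) j 0 with hf
  have hfsum : HasSum f (0 - c j * H j + ∑ i ∈ range (j + 1), v i / D i) := hL.update j 0
  have hHj : H j = 1 := by rw [hHle j le_rfl, if_pos rfl]
  have hfle : ∀ n, ‖f n‖ ≤ (p : ℝ)⁻¹ := by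
    intro n
    rcases lt_trichotomy n j with hlt | rfl | hgt
    · rw [hf, Function.update_of_ne hlt.ne, hHle n hlt.le, if_neg hlt.ne, mul_zero, norm_zero]
      positivity
    · rw [hf, Function.update_self, norm_zero]; positivity
    · rw [hf, Function.update_of_ne hgt.ne']; exact hHgt n hgt
  refine ⟨0 - c j * H j + ∑ i ∈ range (j + 1), v i / D i, ?_, ?_⟩
  · -- ultrametric bound on the sum of `f`
    refine le_of_tendsto' (hfsum.tendsto_sum_nat.norm) fun m ↦ ?_
    exact IsUltrametricDist.norm_sum_le_of_forall_le_of_nonneg (by positivity) fun n _ ↦ hfle n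
  · rw [hHj, mul_one]; ring

/-- **`‖L_j‖ < 1 ⟺ c_j ≡ 0 (mod p)`** (nodes in `pℤ_p`). [cite: Greenberg2001PastPresent, §4 p. 356] -/
theorem norm_lagrangeSum_lt_one_iff {g : PowerSeries ℤ_[p]} (x : ℕ → ℤ_[p]) (hx : ∀ i, ‖x i‖ < 1)
    {j : ℕ} (hinj : Set.InjOn (fun i ↦ (x i : ℚ_[p])) (range (j + 1))) (v : ℕ → ℚ_[p])
    (hv : ∀ i ∈ range (j + 1),
      HasSum (fun n ↦ ((PowerSeries.coeff n g : ℤ_[p]) : ℚ_[p]) * (x i : ℚ_[p]) ^ n) (v i)) :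
    ‖∑ i ∈ range (j + 1), v i / ∏ k ∈ (range (j + 1)).erase i, ((x i : ℚ_[p]) - x k)‖ < 1 ↔
      PowerSeries.coeff j (PowerSeries.map (PadicInt.toZMod (p := p)) g) = 0 := by
  have pp : p.Prime := Fact.out
  obtain ⟨t, ht, hL⟩ := exists_lagrangeSum_eq_coeff_add x hx hinj v hv
  have hp1 : (p : ℝ)⁻¹ < 1 := inv_lt_one_of_one_lt₀ (by exact_mod_cast pp.one_lt)
  have ht1 : ‖t‖ < 1 := ht.trans_lt hp1
  rw [hL, PowerSeries.coeff_map, ← RingHom.mem_ker, PadicInt.ker_toZMod, IsLocalRing.mem_maximalIdeal,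
    mem_nonunits_iff, PadicInt.isUnit_iff, ← PadicInt.padic_norm_e_of_padicInt]
  set cj : ℚ_[p] := ((PowerSeries.coeff j g : ℤ_[p]) : ℚ_[p]) with hcj
  have hcj1 : ‖cj‖ ≤ 1 := by rw [hcj, PadicInt.padic_norm_e_of_padicInt]; exact PadicInt.norm_le_one _
  constructor
  · intro h hc1
    -- `‖cj‖ = 1 > ‖t‖` forces `‖cj + t‖ = 1`
    have hne : ‖cj‖ ≠ ‖t‖ := by rw [hc1]; exact ht1.ne'
    have := IsUltrametricDist.norm_add_eq_max_of_norm_ne_norm hne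
    rw [this, hc1, max_eq_left ht1.le] at h
    exact lt_irrefl _ h
  · intro hc1
    have hlt : ‖cj‖ < 1 := lt_of_le_of_ne hcj1 hc1
    calc ‖cj + t‖ ≤ max ‖cj‖ ‖t‖ := IsUltrametricDist.norm_add_le_max _ _
      _ < 1 := max_lt hlt ht1

/-! ## §3 The certificate -/

/-- **The `λ`-certificate.** Let `g = ∑ cₙ Tⁿ ∈ Λ = ℤ_p⟦T⟧`, `x_0, …, x_a ∈ pℤ_p` distinct, and `v_k`
the value of `g` at `x_k` (`k ≤ a`). If the divided differences
`L_j = ∑_{i≤j} v_i / ∏_{k≤j, k≠i} (x_i − x_k)` satisfy `‖L_j‖ < 1` for `j < a` and `‖L_a‖ = 1`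
(equivalently `≥ 1`), then `ord_T(g mod p) = a`: by §2, `c_j ≡ 0 (mod p)` for `j < a` and
`c_a ≢ 0`. [cite: Greenberg2001PastPresent, §4 pp. 355–356] -/
theorem order_toNat_eq_of_lagrangeSum {g : PowerSeries ℤ_[p]} (x : ℕ → ℤ_[p]) (hx : ∀ i, ‖x i‖ < 1)
    {a : ℕ} (hinj : Set.InjOn (fun i ↦ (x i : ℚ_[p])) (range (a + 1))) (v : ℕ → ℚ_[p])
    (hv : ∀ i ∈ range (a + 1),
      HasSum (fun n ↦ ((PowerSeries.coeff n g : ℤ_[p]) : ℚ_[p]) * (x i : ℚ_[p]) ^ n) (v i))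
    (hlt : ∀ j < a, ‖∑ i ∈ range (j + 1), v i / ∏ k ∈ (range (j + 1)).erase i, ((x i : ℚ_[p]) - x k)‖ < 1)
    (hge : 1 ≤ ‖∑ i ∈ range (a + 1), v i / ∏ k ∈ (range (a + 1)).erase i, ((x i : ℚ_[p]) - x k)‖) :
    (PowerSeries.map (PadicInt.toZMod (p := p)) g).order.toNat = a := by
  have hinj' : ∀ j ≤ a, Set.InjOn (fun i ↦ (x i : ℚ_[p])) (range (j + 1)) := fun j hj ↦
    hinj.mono (by
      intro i hi
      simp only [coe_range, Set.mem_Iio] at hi ⊢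
      omega)
  have hv' : ∀ j ≤ a, ∀ i ∈ range (j + 1),
      HasSum (fun n ↦ ((PowerSeries.coeff n g : ℤ_[p]) : ℚ_[p]) * (x i : ℚ_[p]) ^ n) (v i) :=
    fun j hj i hi ↦ hv i (by simp only [mem_range] at hi ⊢; omega)
  have hzero : ∀ j < a, PowerSeries.coeff j (PowerSeries.map (PadicInt.toZMod (p := p)) g) = 0 :=
    fun j hj ↦ (norm_lagrangeSum_lt_one_iff x hx (hinj' j hj.le) v (hv' j hj.le)).mp (hlt j hj)
  have hne : PowerSeries.coeff a (PowerSeries.map (PadicInt.toZMod (p := p)) g) ≠ 0 := fun h ↦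
    (not_lt.mpr hge) ((norm_lagrangeSum_lt_one_iff x hx (hinj' a le_rfl) v (hv' a le_rfl)).mpr h)
  have hord : (PowerSeries.map (PadicInt.toZMod (p := p)) g).order = a :=
    PowerSeries.order_eq_nat.mpr ⟨hne, fun i hi ↦ hzero i hi⟩
  rw [hord]
  rfl

end Literature.NumberTheory.EllipticCurves

end
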